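import Mathlib.LinearAlgebra.Matrix.NonsingularInverse
import Mathlib.Data.Real.Basic
import Mathlib.Tactic.Linarith
import HarnessLib

/-!
# Simplex method: the ratio test and the relative cost coefficients (Luenberger–Ye, §3.2–3.3)

[LY08] = D. G. Luenberger, Y. Ye, *Linear and Nonlinear Programming* [LuenbergerYe2008], chapter
"The simplex method" (Ch. 3 in the held copy `book:luenberger2008-linear-nonlinear-programming` and in
the Springer 2008 printing), §3.2 "Adjacent extreme points" — bringing `a_q` into the basis along
(15) `x_B(ε) = y_0 − εy_q`, feasibility is kept up to the ratio test (16)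
`ε = min_i {x_i/y_iq : y_iq > 0}` and "if none of the `y_iq`'s are positive … the set K of feasible
solutions is unbounded" — and §3.3 "Determining a minimum feasible solution": (21) the basic variables
in terms of the nonbasic ones, (22)/(24) `cᵀx = z_0 + Σ_j (c_j − z_j)x_j` with (20) `z_0 = c_Bᵀx_B`,
(23) `z_j = c_Bᵀy_j`, the **Improvement of basic feasible solution** theorem (`c_j − z_j < 0` ⇒ a
cheaper feasible solution; unbounded below if `a_j` cannot enter) and the **Optimality Condition
Theorem** (`c_j − z_j ≥ 0` for all `j` ⇒ optimal); `r_j = c_j − z_j` are the relative (reduced) cost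
coefficients.

Matrix form recorded (basis matrix `B : m × m` nonsingular, nonbasic columns `N : m × k`):
`simplexTableau B N = B⁻¹N` (the `y_j`), `simplexBasicValue B b = B⁻¹b` (`y_0`), `simplexReducedCost B N c_B c_N =
c_N − (B⁻¹N)ᵀc_B` (`r`); (21) `basic_eq_of_constraint`; (22)/(24) `cost_eq_basicCost_add_reducedCost`;
Optimality Condition Theorem `optimal_of_reducedCost_nonneg`; the single-column move (15):
`cost_along_column` (`z(ε) = z_0 + εr_q`), `constraint_along_column` (it solves `Ax = b`),
`ratioTest_nonneg` (feasible for `ε` below every ratio (16)), `ratioTest_hits_zero` (the minimizing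
row leaves), `feasible_along_column_of_nonpos` and `cost_unbounded_below` (no positive `y_iq` and
`r_q < 0` ⇒ objective → −∞ along feasible points).

Published results only (Lean placement rule): every public declaration carries its
`[cite: LuenbergerYe2008, §3.2/§3.3 …]` locator.
-/

namespace Literature.Analysis.Convex.SimplexReducedCosts

open Matrix

variable {m k : Type*} [Fintype m] [Fintype k] [DecidableEq m]

/-- The current simplexTableau columns of the nonbasic vectors: `y_j = B⁻¹a_j`, i.e. `Y = B⁻¹N`.
[cite: LuenbergerYe2008, §3.3 (18), (23)] -/
noncomputable def simplexTableau (B : Matrix m m ℝ) (N : Matrix m k ℝ) : Matrix m k ℝ := B⁻¹ * N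

/-- The basic solution `y_0 = B⁻¹b` (`x_B = y_0`, `x_N = 0`). [cite: LuenbergerYe2008, §3.3 (18)-(20)] -/
noncomputable def simplexBasicValue (B : Matrix m m ℝ) (b : m → ℝ) : m → ℝ := B⁻¹ *ᵥ b

/-- Relative (reduced) cost coefficients `r_j = c_j − z_j`, `z_j = c_Bᵀy_j` (23):
`r = c_N − (B⁻¹N)ᵀc_B`. [cite: LuenbergerYe2008, §3.3 (23) and r_j = c_j − z_j] -/
noncomputable def simplexReducedCost (B : Matrix m m ℝ) (N : Matrix m k ℝ) (cB : m → ℝ) (cN : k → ℝ) :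
    k → ℝ := cN - (simplexTableau B N)ᵀ *ᵥ cB

/-- (21): any solution of `Bx_B + Nx_N = b` has `x_B = y_0 − Yx_N`.
[cite: LuenbergerYe2008, §3.3 (21)] -/
theorem basic_eq_of_constraint {B : Matrix m m ℝ} (hB : IsUnit B.det) (N : Matrix m k ℝ) (b : m → ℝ)
    {xB : m → ℝ} {xN : k → ℝ} (h : B *ᵥ xB + N *ᵥ xN = b) :
    xB = simplexBasicValue B b - simplexTableau B N *ᵥ xN := by
  unfold simplexBasicValue simplexTableau
  have := congrArg (fun v => B⁻¹ *ᵥ v) h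
  simp only [mulVec_add, mulVec_mulVec, nonsing_inv_mul _ hB, one_mulVec] at this
  rw [← this, ← mulVec_mulVec, add_sub_cancel_right]

/-- (22)/(24): along the solutions of `Ax = b` the objective is `cᵀx = z_0 + rᵀx_N` with
`z_0 = c_Bᵀy_0`. [cite: LuenbergerYe2008, §3.3 (22), (24)] -/
theorem cost_eq_basicCost_add_reducedCost {B : Matrix m m ℝ} (hB : IsUnit B.det) (N : Matrix m k ℝ)
    (b : m → ℝ) (cB : m → ℝ) (cN : k → ℝ) {xB : m → ℝ} {xN : k → ℝ}
    (h : B *ᵥ xB + N *ᵥ xN = b) :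
    cB ⬝ᵥ xB + cN ⬝ᵥ xN = cB ⬝ᵥ simplexBasicValue B b + simplexReducedCost B N cB cN ⬝ᵥ xN := by
  rw [basic_eq_of_constraint hB N b h, simplexReducedCost, dotProduct_sub, sub_dotProduct, mulVec_transpose,
    ← dotProduct_mulVec]
  ring

/-- **Optimality Condition Theorem**: if `r_j ≥ 0` for all `j`, the basic feasible solution
(cost `z_0`) is optimal among all solutions of `Ax = b`, `x ≥ 0` (only `x_N ≥ 0` is used).
[cite: LuenbergerYe2008, §3.3 Optimality Condition Theorem] -/
theorem optimal_of_reducedCost_nonneg {B : Matrix m m ℝ} (hB : IsUnit B.det) (N : Matrix m k ℝ)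
    (b : m → ℝ) (cB : m → ℝ) (cN : k → ℝ) (hr : ∀ j, 0 ≤ simplexReducedCost B N cB cN j)
    {xB : m → ℝ} {xN : k → ℝ} (h : B *ᵥ xB + N *ᵥ xN = b) (hxN : ∀ j, 0 ≤ xN j) :
    cB ⬝ᵥ simplexBasicValue B b ≤ cB ⬝ᵥ xB + cN ⬝ᵥ xN := by
  rw [cost_eq_basicCost_add_reducedCost hB N b cB cN h]
  have : 0 ≤ simplexReducedCost B N cB cN ⬝ᵥ xN := Finset.sum_nonneg fun j _ => mul_nonneg (hr j) (hxN j)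
  linarith

/-- (15): moving the nonbasic variable `q` to `ε` (others zero) and `x_B(ε) = y_0 − εy_q` keeps
`Ax = b`. [cite: LuenbergerYe2008, §3.2 (15)] -/
theorem constraint_along_column [DecidableEq k] {B : Matrix m m ℝ} (hB : IsUnit B.det)
    (N : Matrix m k ℝ) (b : m → ℝ) (q : k) (ε : ℝ) :
    B *ᵥ (simplexBasicValue B b - ε • (fun i => simplexTableau B N i q)) + N *ᵥ Pi.single q ε = b := by
  have hcol : (fun i => simplexTableau B N i q) = B⁻¹ *ᵥ (fun i => N i q) := by
    ext i; simp [simplexTableau, mul_apply, mulVec, dotProduct]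
  have hN : N *ᵥ Pi.single q ε = ε • (fun i => N i q) := by
    ext i; simp [mulVec, dotProduct, Pi.single_apply, mul_comm]
  rw [hcol, hN, simplexBasicValue, mulVec_sub, mulVec_smul, mulVec_mulVec, mulVec_mulVec, mul_nonsing_inv _ hB,
    one_mulVec, one_mulVec, sub_add_cancel]

/-- Improvement theorem, quantitative core: along (15) the objective is `z(ε) = z_0 + εr_q`, so a
negative relative cost `r_q` makes every `ε > 0` cheaper. [cite: LuenbergerYe2008, §3.3 Theorem (Improvement of basic feasible solution), proof] -/
theorem cost_along_column [DecidableEq k] {B : Matrix m m ℝ} (hB : IsUnit B.det) (N : Matrix m k ℝ)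
    (b : m → ℝ) (cB : m → ℝ) (cN : k → ℝ) (q : k) (ε : ℝ) :
    cB ⬝ᵥ (simplexBasicValue B b - ε • (fun i => simplexTableau B N i q)) + cN ⬝ᵥ Pi.single q ε
      = cB ⬝ᵥ simplexBasicValue B b + ε * simplexReducedCost B N cB cN q := by
  rw [cost_eq_basicCost_add_reducedCost hB N b cB cN (constraint_along_column hB N b q ε),
    dotProduct_single, mul_comm]

omit [Fintype m] [DecidableEq m] in
/-- Ratio test (16), feasibility: if `y_0 ≥ 0` and `0 ≤ ε ≤ y_i0/y_iq` for every row with `y_iq > 0`,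
then `x_B(ε) = y_0 − εy_q ≥ 0`. [cite: LuenbergerYe2008, §3.2 (15)-(16)] -/
theorem ratioTest_nonneg {y0 yq : m → ℝ} (hy0 : ∀ i, 0 ≤ y0 i) {ε : ℝ} (hε : 0 ≤ ε)
    (hratio : ∀ i, 0 < yq i → ε ≤ y0 i / yq i) (i : m) : 0 ≤ y0 i - ε * yq i := by
  rcases lt_or_ge 0 (yq i) with h | h
  · have := hratio i h
    rw [le_div_iff₀ h] at this
    linarith
  · nlinarith [hy0 i]

omit [Fintype m] [DecidableEq m] in
/-- Ratio test (16), the leaving vector: at `ε = y_p0/y_pq` (`y_pq > 0`) the `p`-th basic variable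
vanishes. [cite: LuenbergerYe2008, §3.2 (16)] -/
theorem ratioTest_hits_zero {y0 yq : m → ℝ} {p : m} (hp : 0 < yq p) :
    y0 p - (y0 p / yq p) * yq p = 0 := by
  rw [div_mul_cancel₀ _ hp.ne', sub_self]

omit [Fintype m] [DecidableEq m] in
/-- "If none of the `y_iq`'s are positive": every `ε ≥ 0` stays feasible.
[cite: LuenbergerYe2008, §3.2 paragraph after (16)] -/
theorem feasible_along_column_of_nonpos {y0 yq : m → ℝ} (hy0 : ∀ i, 0 ≤ y0 i)
    (hyq : ∀ i, yq i ≤ 0) {ε : ℝ} (hε : 0 ≤ ε) (i : m) : 0 ≤ y0 i - ε * yq i := by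
  nlinarith [hy0 i, hyq i]

/-- Improvement theorem, unbounded case: with no positive `y_iq` and `r_q < 0` the objective
`z_0 + εr_q` along the feasible ray falls below any bound. [cite: LuenbergerYe2008, §3.3 Theorem (Improvement of basic feasible solution), last assertion] -/
theorem cost_unbounded_below {z0 rq : ℝ} (hr : rq < 0) (M : ℝ) : ∃ ε : ℝ, 0 ≤ ε ∧ z0 + ε * rq < M := by
  refine ⟨max 0 ((M - z0) / rq + 1), le_max_left _ _, ?_⟩
  have h1 : ((M - z0) / rq + 1) * rq < M - z0 := by
    have : ((M - z0) / rq + 1) * rq = (M - z0) + rq := by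
      rw [add_mul, div_mul_cancel₀ _ hr.ne, one_mul]
    linarith
  have h2 : max 0 ((M - z0) / rq + 1) * rq ≤ ((M - z0) / rq + 1) * rq :=
    mul_le_mul_of_nonpos_right (le_max_right _ _) hr.le
  linarith

end Literature.Analysis.Convex.SimplexReducedCosts
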